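import Mathlib
import Summits.CriticalPhenomena.CardyFormulaZ2.Theorems.CardyMagicRigidityNestingRigidityPatternCountStability
import Literature.Probability.Percolation.FKLoopNestingIntegrable
import HarnessLib

/-!
# Critical radii: margin pattern counts are eventually constant off a Lebesgue-null set

Crux `Summit.CriticalPhenomena.CardyFormulaZ2.Theses.CardyMagicRigidity.NestingRigidity`
(stmt-CriticalPhenomena-4835), line `positive-cone-weight-doubling`, step (1b) of the registered stub
`stub_treeRigidity` (regular limits + `NestingLawAgreement` ⇒ `d_CN(bond_{δₖ}, site_{δₖ}) → 0`).
Step (1) is the a.s. continuity of the pattern counts `N_S = patternCount` at the limit; the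
companion `…PatternCountStability` (p100341) proved stability WITH MARGINS,
`N_S(c; r + η, R − η) ≤ N_S(c'; r, R)` for `d_CN(c, c') ≤ ε ≤ η`.  Here the margins are removed at
NON-CRITICAL data, and criticality is shown to be Lebesgue-null:

* §1 `patternLoops_mono`, `patternCount_anti`, `patternCount_margin_le_margin` — the counted set
  shrinks when the discs grow and the window shrinks (for `i ∉ S` a fatter avoided disc is a
  stronger condition too): margin counts are monotone in the margin.
* §2 CRITICAL RADII of a loop `u`: the surround clause `B̄(x i, ρ) ⊆ {W ≠ 0}` and the avoidance
  clause `B̄(x i, ρ) ∩ ({W ≠ 0} ∪ trace) = ∅` change truth value only at `ρ = 0` (empty disc) and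
  `ρ = dist(x i, trace u)` (`W(u, ·)` is locally constant off the trace,
  `UnbasedLoop.wind_eq_wind_of_dist_lt`, and vanishes on the trace, which the closed disc of critical
  radius touches); the window clause `trace ⊆ B(0, R)` changes only at the OUTER RADIUS
  `max_{trace} ‖·‖` (`range_subset_ball_zero_iff`).  Off these values the three clauses pass from
  margin `−η` to margin `+η` (`patternClauses_of_margin`).
* §3 `patternCount_margin_eventually_eq` (registered) — locally finite `c`, some surrounded disc of
  positive radius, no radius zero, `(r, R)` off the critical values of the finitely many loops that
  can be counted near `(r, R)` (trace in `B(0, R + 1)`, diameter `≥ r i₀ / 2`): then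
  `N_S(c; r ± η, R ∓ η) = N_S(c; r, R)` for all small `η > 0` (the three counted sets coincide).
* §4 `countable_loops_diam_pos`, `volume_setOf_critical_eq_zero` (registered),
  `ae_patternCount_margin_eventually_eq` (registered) — a locally finite configuration has
  countably many loops of positive diameter, so its critical data lie in a countable union of
  coordinate hyperplanes of `(Fin n → ℝ) × ℝ`, Lebesgue-null (`Measure.pi_hyperplane`,
  `Real.volume_singleton`): for `volume`-a.e. `(r, R)` the conclusion of §3 holds.
* §5 `ae_ae_patternCount_margin_eventually_eq` — the Fubini form for a random configuration with
  a.s. locally finite values, under an EXPLICIT joint-measurability hypothesis on the criticality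
  relation (without it the section swap is not a theorem: Sierpiński-type sets).
-/

noncomputable section

open MeasureTheory Set Filter Metric
open scoped Real Topology BigOperators ENNReal

namespace Summit.CriticalPhenomena.CardyFormulaZ2.Cruxes.NestingRigidity.PositiveConeWeightDoubling

open Literature.Probability.RandomPlanarGeometry Literature.Probability.Percolation
  Literature.Probability.LatticeModels
open Summit.CriticalPhenomena.CardyFormulaZ2.Cruxes.NestingRigidity.RingCloudTomography

/-! ## §1 Monotonicity in the radii and in the window -/

/-- **The counted set of `N_S` shrinks when the discs grow and the window shrinks**: a loop with
trace in the smaller window, surrounding the bigger discs `i ∈ S` and avoiding (interior and trace)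
the bigger discs `i ∉ S` has trace in the bigger window, surrounds the smaller discs `i ∈ S` and
avoids the smaller discs `i ∉ S`. -/
theorem patternLoops_mono {n : ℕ} (c : LoopConfig ℂ) (x : Fin n → ℂ) {r r' : Fin n → ℝ}
    {R R' : ℝ} (S : Finset (Fin n)) (hr : ∀ i, r i ≤ r' i) (hR : R' ≤ R) :
    {u ∈ c.loops | u.range ⊆ ball (0 : ℂ) R' ∧
        (∀ i ∈ S, closedBall (x i) (r' i) ⊆ {w | u.wind w ≠ 0}) ∧
        ∀ i, i ∉ S → Disjoint (closedBall (x i) (r' i)) ({w | u.wind w ≠ 0} ∪ u.range)} ⊆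
    {u ∈ c.loops | u.range ⊆ ball (0 : ℂ) R ∧
        (∀ i ∈ S, closedBall (x i) (r i) ⊆ {w | u.wind w ≠ 0}) ∧
        ∀ i, i ∉ S → Disjoint (closedBall (x i) (r i)) ({w | u.wind w ≠ 0} ∪ u.range)} := by
  rintro u ⟨hul, hur, hsur, havoid⟩
  exact ⟨hul, hur.trans (ball_subset_ball hR),
    fun i hi ↦ (closedBall_subset_closedBall (hr i)).trans (hsur i hi),
    fun i hi ↦ (havoid i hi).mono_left (closedBall_subset_closedBall (hr i))⟩

/-- **`N_S` is antitone in the radii and monotone in the window**, as soon as the bigger counted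
set is finite (`Set.ncard` of an infinite set is the junk value `0`). -/
theorem patternCount_anti {n : ℕ} (c : LoopConfig ℂ) (x : Fin n → ℂ) {r r' : Fin n → ℝ} {R R' : ℝ}
    (S : Finset (Fin n)) (hr : ∀ i, r i ≤ r' i) (hR : R' ≤ R)
    (hfin : {u ∈ c.loops | u.range ⊆ ball (0 : ℂ) R ∧
        (∀ i ∈ S, closedBall (x i) (r i) ⊆ {w | u.wind w ≠ 0}) ∧
        ∀ i, i ∉ S → Disjoint (closedBall (x i) (r i)) ({w | u.wind w ≠ 0} ∪ u.range)}.Finite) :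
    patternCount c x r' R' S ≤ patternCount c x r R S :=
  Set.ncard_le_ncard (patternLoops_mono c x S hr hR) hfin

/-- **The margin counts are monotone in the margin** (locally finite configuration, some surrounded
disc non-degenerate at the smaller margin): for `η' ≤ η`,
`N_S(c; r + η, R − η) ≤ N_S(c; r + η', R − η')`. -/
theorem patternCount_margin_le_margin {c : LoopConfig ℂ} (hc : c.IsLocallyFinite) {n : ℕ}
    (x : Fin n → ℂ) (r : Fin n → ℝ) (R : ℝ) (S : Finset (Fin n)) {i : Fin n} (hi : i ∈ S)
    {η η' : ℝ} (hle : η' ≤ η) (hri : 0 < r i + η') :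
    patternCount c x (fun j ↦ r j + η) (R - η) S ≤ patternCount c x (fun j ↦ r j + η') (R - η') S :=
  patternCount_anti c x S (fun j ↦ by linarith) (by linarith)
    (finite_patternLoops_of_isLocallyFinite hc x (fun j ↦ r j + η') (R - η') S hi hri)

/-! ## §2 Critical radii of one loop -/

/-- Below the critical radius `dist(z, trace)`, a closed disc about a surrounded centre is
surrounded: the winding number is constant on it (`UnbasedLoop.wind_eq_wind_of_dist_lt`). -/
theorem closedBall_subset_setOf_wind_ne_zero (u : UnbasedLoop ℂ) {z : ℂ} {ρ : ℝ}
    (hz : u.wind z ≠ 0) (hρ : ρ < infDist z u.range) : closedBall z ρ ⊆ {w | u.wind w ≠ 0} := by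
  intro w hw
  rw [mem_setOf_eq, u.wind_eq_wind_of_dist_lt ((mem_closedBall.1 hw).trans_lt hρ)]
  exact hz

/-- Below the critical radius `dist(z, trace)`, a closed disc about an exterior centre off the
trace is avoided by the interior and by the trace. -/
theorem disjoint_closedBall_of_wind_eq_zero (u : UnbasedLoop ℂ) {z : ℂ} {ρ : ℝ}
    (hz : u.wind z = 0) (hρ : ρ < infDist z u.range) :
    Disjoint (closedBall z ρ) ({w | u.wind w ≠ 0} ∪ u.range) := by
  rw [Set.disjoint_left]
  rintro w hw (hw' | hw')
  · exact hw' (by rw [u.wind_eq_wind_of_dist_lt ((mem_closedBall.1 hw).trans_lt hρ)]; exact hz)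
  · exact notMem_of_dist_lt_infDist (x := z)
      (by rw [dist_comm]; exact (mem_closedBall.1 hw).trans_lt hρ) hw'

/-- From the critical radius on, a closed disc is NOT surrounded: it contains a nearest point of
the (compact, non-empty) trace, where the winding number vanishes. -/
theorem not_closedBall_subset_of_infDist_le (u : UnbasedLoop ℂ) {z : ℂ} {ρ : ℝ}
    (hρ : infDist z u.range ≤ ρ) : ¬ closedBall z ρ ⊆ {w | u.wind w ≠ 0} := by
  obtain ⟨y, hy, hyz⟩ := u.isCompact_range.exists_infDist_eq_dist u.range_nonempty z
  exact fun h ↦ h (mem_closedBall.2 (by rw [dist_comm, ← hyz]; exact hρ))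
    (unbasedLoop_wind_of_mem_range u hy)

/-- From the critical radius on, a closed disc is NOT avoided: it contains a nearest point of the
trace. -/
theorem not_disjoint_closedBall_of_infDist_le (u : UnbasedLoop ℂ) {z : ℂ} {ρ : ℝ}
    (hρ : infDist z u.range ≤ ρ) : ¬ Disjoint (closedBall z ρ) ({w | u.wind w ≠ 0} ∪ u.range) := by
  obtain ⟨y, hy, hyz⟩ := u.isCompact_range.exists_infDist_eq_dist u.range_nonempty z
  rw [Set.not_disjoint_iff]
  exact ⟨y, mem_closedBall.2 (by rw [dist_comm, ← hyz]; exact hρ), Or.inr hy⟩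

/-- The OUTER RADIUS `sup_{trace} ‖·‖` of a loop is attained on the (compact, non-empty) trace. -/
theorem exists_norm_eq_sSup (u : UnbasedLoop ℂ) :
    ∃ y ∈ u.range, ‖y‖ = sSup ((fun z : ℂ ↦ ‖z‖) '' u.range) := by
  have hK : IsCompact ((fun z : ℂ ↦ ‖z‖) '' u.range) := u.isCompact_range.image continuous_norm
  obtain ⟨y, hy, hy'⟩ := (mem_image _ _ _).1 (hK.sSup_mem (u.range_nonempty.image _))
  exact ⟨y, hy, hy'⟩

/-- Every trace point has norm at most the outer radius. -/
theorem norm_le_sSup (u : UnbasedLoop ℂ) {y : ℂ} (hy : y ∈ u.range) :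
    ‖y‖ ≤ sSup ((fun z : ℂ ↦ ‖z‖) '' u.range) :=
  le_csSup (u.isCompact_range.bddAbove_image continuous_norm.continuousOn) (mem_image_of_mem _ hy)

/-- **The window clause is critical only at the outer radius**: `trace u ⊆ B(0, R)` iff the outer
radius is `< R`. -/
theorem range_subset_ball_zero_iff (u : UnbasedLoop ℂ) {R : ℝ} :
    u.range ⊆ ball (0 : ℂ) R ↔ sSup ((fun z : ℂ ↦ ‖z‖) '' u.range) < R := by
  obtain ⟨y₀, hy₀, hy₀'⟩ := exists_norm_eq_sSup u
  refine ⟨fun h ↦ ?_, fun h y hy ↦ mem_ball_zero_iff.2 ((norm_le_sSup u hy).trans_lt h)⟩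
  rw [← hy₀']
  exact mem_ball_zero_iff.1 (h hy₀)

/-- **Off the critical values, the three clauses of `N_S` pass from margin `−η` to margin `+η`.**
If `η` is smaller than `|R − outer radius|`, than every `|r i|` and than every
`|r i − dist(x i, trace u)|`, and `u` has trace in `B(0, R + η)`, surrounds the discs
`B̄(x i, r i − η)`, `i ∈ S`, and avoids the discs `B̄(x i, r i − η)`, `i ∉ S`, then `u` has trace in
`B(0, R − η)`, surrounds `B̄(x i, r i + η)`, `i ∈ S`, and avoids `B̄(x i, r i + η)`, `i ∉ S`.
(A disc of negative radius is empty; for a positive radius the centre decides, by §2.) -/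
theorem patternClauses_of_margin (u : UnbasedLoop ℂ) {n : ℕ} (x : Fin n → ℂ) (r : Fin n → ℝ)
    (R : ℝ) (S : Finset (Fin n)) {η : ℝ} (hR : η < |R - sSup ((fun z : ℂ ↦ ‖z‖) '' u.range)|)
    (hr0 : ∀ i, η < |r i|)
    (hrd : ∀ i, η < |r i - infDist (x i) u.range|) (hwin : u.range ⊆ ball (0 : ℂ) (R + η))
    (hsur : ∀ i ∈ S, closedBall (x i) (r i - η) ⊆ {w | u.wind w ≠ 0})
    (havoid : ∀ i, i ∉ S → Disjoint (closedBall (x i) (r i - η)) ({w | u.wind w ≠ 0} ∪ u.range)) :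
    u.range ⊆ ball (0 : ℂ) (R - η) ∧ (∀ i ∈ S, closedBall (x i) (r i + η) ⊆ {w | u.wind w ≠ 0}) ∧
      ∀ i, i ∉ S → Disjoint (closedBall (x i) (r i + η)) ({w | u.wind w ≠ 0} ∪ u.range) := by
  refine ⟨?_, fun i hi ↦ ?_, fun i hi ↦ ?_⟩
  · -- the window: the outer radius is `< R + η`, hence `< R - η`
    rw [range_subset_ball_zero_iff] at hwin ⊢
    rcases lt_abs.1 hR with h | h <;> linarith
  · -- surrounded discs
    rcases lt_abs.1 (hr0 i) with h0 | h0
    · -- `η < r i`: the centre is surrounded and `r i + η` stays below the critical radius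
      have hx : u.wind (x i) ≠ 0 := hsur i hi (mem_closedBall_self (by linarith))
      rcases lt_abs.1 (hrd i) with h | h
      · exact absurd (hsur i hi) (not_closedBall_subset_of_infDist_le u (by linarith))
      · exact closedBall_subset_setOf_wind_ne_zero u hx (by linarith)
    · -- `r i < -η`: the fattened disc is still empty
      rw [closedBall_eq_empty.2 (by linarith)]
      exact empty_subset _
  · -- avoided discs
    rcases lt_abs.1 (hr0 i) with h0 | h0
    · have hx : x i ∉ {w | u.wind w ≠ 0} ∪ u.range :=
        fun h ↦ (havoid i hi).ne_of_mem (mem_closedBall_self (by linarith)) h rfl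
      have hx0 : u.wind (x i) = 0 := by
        by_contra h
        exact hx (Or.inl h)
      rcases lt_abs.1 (hrd i) with h | h
      · exact absurd (havoid i hi) (not_disjoint_closedBall_of_infDist_le u (by linarith))
      · exact disjoint_closedBall_of_wind_eq_zero u hx0 (by linarith)
    · rw [closedBall_eq_empty.2 (by linarith)]
      exact empty_disjoint _

/-! ## §3 Margin counts are eventually constant at non-critical data -/

/-- **Margin pattern counts are eventually EQUAL at non-critical data** (registered sub-goal).  Let
`c` be locally finite, `i₀ ∈ S` with `0 < r i₀`, no radius zero, and suppose that every loop of `c`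
that can be counted near `(r, R)` — trace in `B(0, R + 1)`, diameter `≥ r i₀ / 2`; finitely many by
local finiteness — has no critical value at `(r, R)`: `r i ≠ dist(x i, trace)` for all `i` and
`R ≠` outer radius.  Then for all small `η > 0`,
`N_S(c; r + η, R − η) = N_S(c; r, R) = N_S(c; r − η, R + η)`: the three counted sets are nested
(§1) and the biggest lies in the smallest (`patternClauses_of_margin`, uniformly over the finite
family: each gap condition holds for all small `η`). -/
theorem patternCount_margin_eventually_eq : ∀ {n : ℕ} (c : LoopConfig ℂ) (x : Fin n → ℂ)
    (r : Fin n → ℝ) (R : ℝ) (S : Finset (Fin n)) (i₀ : Fin n), c.IsLocallyFinite → i₀ ∈ S →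
    0 < r i₀ → (∀ i, r i ≠ 0) → (∀ u ∈ c.loops, u.range ⊆ Metric.ball (0 : ℂ) (R + 1) →
    r i₀ / 2 ≤ Metric.diam u.range → (∀ i, r i ≠ Metric.infDist (x i) u.range) ∧
    R ≠ sSup ((fun z : ℂ ↦ ‖z‖) '' u.range)) → ∃ η₀ : ℝ, 0 < η₀ ∧ ∀ η ∈ Set.Ioo (0 : ℝ) η₀,
    patternCount c x (fun i ↦ r i + η) (R - η) S = patternCount c x r R S ∧
    patternCount c x (fun i ↦ r i - η) (R + η) S = patternCount c x r R S := by
  intro n c x r R S i₀ hc hi₀ hr₀ hr hcrit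
  -- the finitely many loops that can be counted at some margin `η < min 1 (r i₀ / 2)`
  set F : Set (UnbasedLoop ℂ) :=
    {u ∈ c.loops | u.range ⊆ ball (0 : ℂ) (R + 1) ∧ r i₀ / 2 ≤ diam u.range} with hF
  have hFfin : F.Finite := by
    refine ((hc 0 (R + 1) (r i₀ / 2) (by positivity)).union
      (hc 1 (R + 1) (r i₀ / 2) (by positivity))).subset fun u hu ↦ ?_
    rcases LoopConfig.mem_loops_iff.1 hu.1 with h | h
    · exact Or.inl ⟨h, hu.2⟩
    · exact Or.inr ⟨h, hu.2⟩
  -- the gap conditions hold for all small `η`, uniformly over `F`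
  have hev : ∀ᶠ η in 𝓝 (0 : ℝ), ∀ u ∈ F, η < |R - sSup ((fun z : ℂ ↦ ‖z‖) '' u.range)| ∧
      ∀ i, η < |r i| ∧ η < |r i - infDist (x i) u.range| := by
    refine hFfin.eventually_all.2 fun u hu ↦ ?_
    obtain ⟨hcr, hcR⟩ := hcrit u hu.1 hu.2.1 hu.2.2
    refine (eventually_lt_nhds (abs_pos.2 (sub_ne_zero.2 hcR))).and (eventually_all.2 fun i ↦ ?_)
    exact (eventually_lt_nhds (abs_pos.2 (hr i))).and
      (eventually_lt_nhds (abs_pos.2 (sub_ne_zero.2 (hcr i))))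
  obtain ⟨ε, hε, hεP⟩ := Metric.eventually_nhds_iff.1 hev
  refine ⟨min ε (min 1 (r i₀ / 2)), by positivity, fun η hη ↦ ?_⟩
  obtain ⟨hη0, hηlt⟩ := hη
  have hηε : η < ε := hηlt.trans_le (min_le_left _ _)
  have hη1 : η < 1 := hηlt.trans_le ((min_le_right _ _).trans (min_le_left _ _))
  have hηr : η < r i₀ / 2 := hηlt.trans_le ((min_le_right _ _).trans (min_le_right _ _))
  have hgap := hεP (show dist η 0 < ε by
    rwa [dist_zero_right, Real.norm_eq_abs, abs_of_pos hη0])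
  -- the three counted sets `A⁺ ⊆ A ⊆ A⁻ ⊆ A⁺`
  set Ap : Set (UnbasedLoop ℂ) := {u ∈ c.loops | u.range ⊆ ball (0 : ℂ) (R - η) ∧
      (∀ i ∈ S, closedBall (x i) (r i + η) ⊆ {w | u.wind w ≠ 0}) ∧
      ∀ i, i ∉ S → Disjoint (closedBall (x i) (r i + η)) ({w | u.wind w ≠ 0} ∪ u.range)} with hAp
  set A : Set (UnbasedLoop ℂ) := {u ∈ c.loops | u.range ⊆ ball (0 : ℂ) R ∧
      (∀ i ∈ S, closedBall (x i) (r i) ⊆ {w | u.wind w ≠ 0}) ∧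
      ∀ i, i ∉ S → Disjoint (closedBall (x i) (r i)) ({w | u.wind w ≠ 0} ∪ u.range)} with hA
  set Am : Set (UnbasedLoop ℂ) := {u ∈ c.loops | u.range ⊆ ball (0 : ℂ) (R + η) ∧
      (∀ i ∈ S, closedBall (x i) (r i - η) ⊆ {w | u.wind w ≠ 0}) ∧
      ∀ i, i ∉ S → Disjoint (closedBall (x i) (r i - η)) ({w | u.wind w ≠ 0} ∪ u.range)} with hAm
  have h1 : Ap ⊆ A := patternLoops_mono c x S (r := r) (r' := fun i ↦ r i + η)
    (fun i ↦ by linarith) (by linarith)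
  have h2 : A ⊆ Am := patternLoops_mono c x S (r := fun i ↦ r i - η) (r' := r)
    (fun i ↦ by linarith) (by linarith)
  have h3 : Am ⊆ Ap := by
    rintro u ⟨hul, hwin, hsur, havoid⟩
    have huF : u ∈ F := by
      refine ⟨hul, hwin.trans (ball_subset_ball (by linarith)), ?_⟩
      have := le_diam_range_of_closedBall_subset (hsur i₀ hi₀)
      linarith
    obtain ⟨hgR, hgr⟩ := hgap u huF
    exact ⟨hul, patternClauses_of_margin u x r R S hgR (fun i ↦ (hgr i).1) (fun i ↦ (hgr i).2)
      hwin hsur havoid⟩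
  have hApA : Ap = A := h1.antisymm (h2.trans h3)
  have hAmA : Am = A := (h3.trans h1).antisymm h2
  exact ⟨congrArg Set.ncard hApA, congrArg Set.ncard hAmA⟩

/-! ## §4 Criticality is Lebesgue-null -/

/-- **A locally finite configuration has countably many loops of positive diameter**: every such
loop has trace in some window `B(0, m)` and diameter `≥ 1/(k+1)`, `m k : ℕ`, and each of these
countably many families is finite. -/
theorem countable_loops_diam_pos {c : LoopConfig ℂ} (hc : c.IsLocallyFinite) :
    {u ∈ c.loops | 0 < diam u.range}.Countable := by
  have hsub : {u ∈ c.loops | 0 < diam u.range} ⊆ ⋃ m : ℕ, ⋃ k : ℕ,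
      ({u ∈ c.F 0 | u.range ⊆ ball (0 : ℂ) m ∧ 1 / ((k : ℝ) + 1) ≤ diam u.range} ∪
        {u ∈ c.F 1 | u.range ⊆ ball (0 : ℂ) m ∧ 1 / ((k : ℝ) + 1) ≤ diam u.range}) := by
    rintro u ⟨hul, hd⟩
    obtain ⟨ρ, hρ⟩ := u.isCompact_range.isBounded.subset_ball (0 : ℂ)
    obtain ⟨k, hk⟩ := exists_nat_one_div_lt hd
    have hball : u.range ⊆ ball (0 : ℂ) ((⌈ρ⌉₊ : ℕ) : ℝ) :=
      hρ.trans (ball_subset_ball (Nat.le_ceil ρ))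
    refine mem_iUnion.2 ⟨⌈ρ⌉₊, mem_iUnion.2 ⟨k, ?_⟩⟩
    rcases LoopConfig.mem_loops_iff.1 hul with h | h
    · exact Or.inl ⟨h, hball, hk.le⟩
    · exact Or.inr ⟨h, hball, hk.le⟩
  refine Set.Countable.mono hsub (countable_iUnion fun m ↦ countable_iUnion fun k ↦ ?_)
  exact ((hc 0 _ _ (by positivity)).union (hc 1 _ _ (by positivity))).countable

/-- A coordinate hyperplane `{r i = a}` of `(Fin n → ℝ) × ℝ` is Lebesgue-null. -/
theorem volume_setOf_fst_apply_eq {n : ℕ} (i : Fin n) (a : ℝ) :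
    volume {p : (Fin n → ℝ) × ℝ | p.1 i = a} = 0 := by
  have h : {p : (Fin n → ℝ) × ℝ | p.1 i = a} = {f : Fin n → ℝ | f i = a} ×ˢ (univ : Set ℝ) := by
    ext p
    simp
  rw [h, Measure.volume_eq_prod, Measure.prod_prod]
  have h0 : (volume : Measure (Fin n → ℝ)) {f | f i = a} = 0 := by
    rw [volume_pi]
    exact Measure.pi_hyperplane (fun _ : Fin n ↦ (volume : Measure ℝ)) i a
  rw [h0, zero_mul]

/-- The coordinate hyperplane `{R = b}` of `(Fin n → ℝ) × ℝ` is Lebesgue-null. -/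
theorem volume_setOf_snd_eq {n : ℕ} (b : ℝ) : volume {p : (Fin n → ℝ) × ℝ | p.2 = b} = 0 := by
  have h : {p : (Fin n → ℝ) × ℝ | p.2 = b} = (univ : Set (Fin n → ℝ)) ×ˢ ({b} : Set ℝ) := by
    ext p
    simp
  rw [h, Measure.volume_eq_prod, Measure.prod_prod, Real.volume_singleton, mul_zero]

/-- **The critical data of a locally finite configuration are Lebesgue-null** (registered
sub-goal): the set of `(r, R)` with some `r i = 0`, or some `r i = dist(x i, trace u)` or `R =`
outer radius of `u` for some loop `u` of positive diameter, lies in a countable union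
(`countable_loops_diam_pos`) of coordinate hyperplanes. -/
theorem volume_setOf_critical_eq_zero : ∀ {n : ℕ} (c : LoopConfig ℂ) (x : Fin n → ℂ),
    c.IsLocallyFinite → MeasureTheory.volume {p : (Fin n → ℝ) × ℝ | (∃ i, p.1 i = 0) ∨
    ∃ u ∈ c.loops, 0 < Metric.diam u.range ∧ ((∃ i, p.1 i = Metric.infDist (x i) u.range) ∨
    p.2 = sSup ((fun z : ℂ ↦ ‖z‖) '' u.range))} = 0 := by
  intro n c x hc
  have hsub : {p : (Fin n → ℝ) × ℝ | (∃ i, p.1 i = 0) ∨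
      ∃ u ∈ c.loops, 0 < diam u.range ∧ ((∃ i, p.1 i = infDist (x i) u.range) ∨
        p.2 = sSup ((fun z : ℂ ↦ ‖z‖) '' u.range))} ⊆
      (⋃ i : Fin n, {p : (Fin n → ℝ) × ℝ | p.1 i = 0}) ∪
        ⋃ u ∈ {u ∈ c.loops | 0 < diam u.range},
          ((⋃ i : Fin n, {p : (Fin n → ℝ) × ℝ | p.1 i = infDist (x i) u.range}) ∪
            {p : (Fin n → ℝ) × ℝ | p.2 = sSup ((fun z : ℂ ↦ ‖z‖) '' u.range)}) := by
    rintro p (⟨i, hi⟩ | ⟨u, hu, hd, h⟩)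
    · exact Or.inl (mem_iUnion.2 ⟨i, hi⟩)
    · refine Or.inr (mem_biUnion (x := u) ⟨hu, hd⟩ ?_)
      rcases h with ⟨i, hi⟩ | h
      · exact Or.inl (mem_iUnion.2 ⟨i, hi⟩)
      · exact Or.inr h
  refine measure_mono_null hsub (measure_union_null ?_ ?_)
  · exact measure_iUnion_null fun i ↦ volume_setOf_fst_apply_eq i 0
  · refine (measure_biUnion_null_iff (countable_loops_diam_pos hc)).2 fun u _ ↦ ?_
    exact measure_union_null (measure_iUnion_null fun i ↦ volume_setOf_fst_apply_eq i _)
      (volume_setOf_snd_eq _)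

/-- **Non-critical data: the deterministic conclusion.**  If `(r, R) = p` is not a critical datum
of the locally finite configuration `c` (in the sense of `volume_setOf_critical_eq_zero`) and some
surrounded disc has positive radius, the margin counts at `p` are eventually equal
(`patternCount_margin_eventually_eq`: a loop of diameter `≥ r i₀ / 2 > 0` has positive diameter). -/
theorem patternCount_margin_eventually_eq_of_notMem {c : LoopConfig ℂ} (hc : c.IsLocallyFinite)
    {n : ℕ} (x : Fin n → ℂ) (S : Finset (Fin n)) {p : (Fin n → ℝ) × ℝ}
    (hp : p ∉ {p : (Fin n → ℝ) × ℝ | (∃ i, p.1 i = 0) ∨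
      ∃ u ∈ c.loops, 0 < diam u.range ∧ ((∃ i, p.1 i = infDist (x i) u.range) ∨
        p.2 = sSup ((fun z : ℂ ↦ ‖z‖) '' u.range))})
    (hS : ∃ i ∈ S, 0 < p.1 i) :
    ∃ η₀ : ℝ, 0 < η₀ ∧ ∀ η ∈ Ioo (0 : ℝ) η₀,
      patternCount c x (fun i ↦ p.1 i + η) (p.2 - η) S = patternCount c x p.1 p.2 S ∧
      patternCount c x (fun i ↦ p.1 i - η) (p.2 + η) S = patternCount c x p.1 p.2 S := by
  obtain ⟨i₀, hi₀, hri₀⟩ := hS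
  rw [mem_setOf_eq] at hp
  push Not at hp
  obtain ⟨hp0, hpu⟩ := hp
  exact patternCount_margin_eventually_eq c x p.1 p.2 S i₀ hc hi₀ hri₀ hp0
    fun u hu _ hdiam ↦ hpu u hu (by linarith)

/-- **For Lebesgue-a.e. radii the margin counts are eventually constant** (registered sub-goal; the
packaged form of §3–§4): in a locally finite configuration, for `volume`-a.e.
`p = (r, R) : (Fin n → ℝ) × ℝ`, as soon as some surrounded disc has positive radius there is
`η₀ > 0` with `N_S(c; r + η, R − η) = N_S(c; r, R) = N_S(c; r − η, R + η)` for all `η ∈ (0, η₀)`. -/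
theorem ae_patternCount_margin_eventually_eq : ∀ {n : ℕ} (c : LoopConfig ℂ) (x : Fin n → ℂ)
    (S : Finset (Fin n)), c.IsLocallyFinite → ∀ᵐ p : (Fin n → ℝ) × ℝ, (∃ i ∈ S, 0 < p.1 i) →
    ∃ η₀ : ℝ, 0 < η₀ ∧ ∀ η ∈ Set.Ioo (0 : ℝ) η₀,
    patternCount c x (fun i ↦ p.1 i + η) (p.2 - η) S = patternCount c x p.1 p.2 S ∧
    patternCount c x (fun i ↦ p.1 i - η) (p.2 + η) S = patternCount c x p.1 p.2 S := by
  intro n c x S hc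
  have h0 := volume_setOf_critical_eq_zero c x hc
  rw [measure_eq_zero_iff_ae_notMem] at h0
  filter_upwards [h0] with p hp
  exact patternCount_margin_eventually_eq_of_notMem hc x S hp

/-! ## §5 The Fubini form for a random configuration -/

/-- **Fubini form.**  Let `X : Ω → LoopConfig ℂ` be a random configuration, a.s. locally finite,
whose criticality relation `{(p, ω) | p is a critical datum of X ω}` is jointly measurable (an
explicit hypothesis: without it the section swap below is not a theorem).  Then for `volume`-a.e.
`p = (r, R)`, almost surely, the margin counts of `X ω` at `p` are eventually equal (as soon as some
surrounded disc has positive radius): the `ω`-sections of the criticality relation are a.s.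
Lebesgue-null (`volume_setOf_critical_eq_zero`), so the relation is `volume ⊗ P`-null
(`Measure.prod_apply_symm`) and a.e. `p`-section is `P`-null (`Measure.ae_ae_of_ae_prod`). -/
theorem ae_ae_patternCount_margin_eventually_eq {Ω : Type*} [MeasurableSpace Ω] (P : Measure Ω)
    [SFinite P] {n : ℕ} (X : Ω → LoopConfig ℂ) (x : Fin n → ℂ) (S : Finset (Fin n))
    (hX : ∀ᵐ ω ∂P, (X ω).IsLocallyFinite)
    (hmeas : MeasurableSet {q : ((Fin n → ℝ) × ℝ) × Ω | (∃ i, q.1.1 i = 0) ∨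
      ∃ u ∈ (X q.2).loops, 0 < diam u.range ∧ ((∃ i, q.1.1 i = infDist (x i) u.range) ∨
        q.1.2 = sSup ((fun z : ℂ ↦ ‖z‖) '' u.range))}) :
    ∀ᵐ p : (Fin n → ℝ) × ℝ, ∀ᵐ ω ∂P, (∃ i ∈ S, 0 < p.1 i) → ∃ η₀ : ℝ, 0 < η₀ ∧
      ∀ η ∈ Ioo (0 : ℝ) η₀,
        patternCount (X ω) x (fun i ↦ p.1 i + η) (p.2 - η) S = patternCount (X ω) x p.1 p.2 S ∧
        patternCount (X ω) x (fun i ↦ p.1 i - η) (p.2 + η) S = patternCount (X ω) x p.1 p.2 S := by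
  set s : Set (((Fin n → ℝ) × ℝ) × Ω) := {q | (∃ i, q.1.1 i = 0) ∨
      ∃ u ∈ (X q.2).loops, 0 < diam u.range ∧ ((∃ i, q.1.1 i = infDist (x i) u.range) ∨
        q.1.2 = sSup ((fun z : ℂ ↦ ‖z‖) '' u.range))} with hs
  have hnull : ((volume : Measure ((Fin n → ℝ) × ℝ)).prod P) s = 0 := by
    rw [Measure.prod_apply_symm hmeas]
    refine (lintegral_congr_ae ?_).trans lintegral_zero
    filter_upwards [hX] with ω hω
    exact volume_setOf_critical_eq_zero (X ω) x hω
  have hae : ∀ᵐ q ∂((volume : Measure ((Fin n → ℝ) × ℝ)).prod P), q ∉ s :=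
    measure_eq_zero_iff_ae_notMem.1 hnull
  filter_upwards [Measure.ae_ae_of_ae_prod hae] with p hp
  filter_upwards [hp, hX] with ω hω hωX
  exact patternCount_margin_eventually_eq_of_notMem hωX x S hω

end Summit.CriticalPhenomena.CardyFormulaZ2.Cruxes.NestingRigidity.PositiveConeWeightDoubling

end
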